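import Summits.HubbardSuperconductivity.HubbardSuperconductivity.Theses.AnisotropyChord
import Summits.AtomisticToContinuum.BoseEinsteinCondensation.Theorems.BECStronglyRayleighSectorGroundStatePerron
import Literature.MathematicalPhysics.QuantumLattice.SectorSpectrum

/-!
# Route `AnisotropyChord`: the glue support `ChordToOrderXY` (stmt-HubbardSuperconductivity-8151)

Notation: `H_M(Δ) = xxzHamiltonian 1 (torusGraph 2 M) (−1) Δ` (spin-½ XXZ torus, `M` even),
`Λ(ψ) = Re⟨ψ, S⁺_tot S⁻_tot ψ⟩` the planar order of a normalised `S^z_tot = 0` sector ground state.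

(The Tier-B twin `ChordToOrderFM` is `Theorems/AnisotropyChordChordToOrderFM.lean`.)

* `chordToOrderXY_proof : ChordToOrderXY` (`ChordXY → SectorAnchorXY → HalfFilledOrder`, Tier A):
  for even `M ≥ max(M₀, 4)` a normalised `S^z_tot = 0` sector ground state `ψ₀` of the KLS point
  `H_M(0) = xyTorus 2 M 1` EXISTS — the Perron vector of the landed BEC-route theorem
  `SectorGroundStatePerron_proof` (`stmt-AtomisticToContinuum-9677`; `d = 2`, `N = M²/2`, sector
  label `M²/2 − M²/2 = 0` for even `M`), normalised by `exists_smul_unit` — so the chord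
  `(1+Δ)Λ(ψ₀) ≤ Λ(ψ)` and the anchor `Λ(ψ₀) ≥ cM⁴` give `Λ(ψ) ≥ (1+Δ)c·M⁴`.

Sources: the route card (idea `anisotropy-chord-xxz`); T. Kennedy, E. H. Lieb, B. S. Shastry,
PRL 61 (1988) 2582; B. Tóth, J. Stat. Phys. 65 (1991) 373; H. Tasaki (2020) §2.4 (sector ground
states). No definition is introduced.
-/

set_option linter.dupNamespace false

noncomputable section

namespace Summit.HubbardSuperconductivity.HubbardSuperconductivity.Theorems.AnisotropyChord

open Matrix Literature.MathematicalPhysics.QuantumLattice Literature.Probability.LatticeModels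
open Summit.HubbardSuperconductivity.HubbardSuperconductivity.Theses.AnisotropyChord
open Summit.AtomisticToContinuum.BoseEinsteinCondensation.Theorems (SectorGroundStatePerron_proof)

/-- **A normalised `S^z_tot = 0` sector ground state of the KLS point exists** on every even torus
of side `M ≥ 2`: the Perron vector of `xyTorus 2 M 1 = H_M(0)` in the sector of `N = M²/2` bosons
(`SectorGroundStatePerron_proof`, BEC route), whose magnetisation label `M²/2 − M²/2` is `0` for even
`M`, normalised. Tasaki (2020) §2.4. [folklore] -/
theorem exists_unit_sectorGroundState_xy (M : ℕ) [NeZero M] (hM : Even M) (h2 : 2 ≤ M) :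
    ∃ ψ₀ : TensorIndex (TorusSite 2 M) 2 → ℂ,
      ψ₀ ∈ spinZSector (Λ := TorusSite 2 M) 1 0 ∧ star ψ₀ ⬝ᵥ ψ₀ = 1 ∧
        xxzHamiltonian 1 (torusGraph 2 M) (-1) 0 *ᵥ ψ₀ =
          ((lowestEnergyInSector 1 (xxzHamiltonian 1 (torusGraph 2 M) (-1) 0) 0 : ℝ) : ℂ) • ψ₀ := by
  obtain ⟨ψ, hψ0, -, hmem, heig, -⟩ :=
    SectorGroundStatePerron_proof 2 M (by norm_num) h2 (M ^ 2 / 2) (Nat.div_le_self _ _)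
  -- the sector label `M²/2 − M²/2 = 0` for even `M`
  have hlabel : ((M ^ 2 / 2 : ℕ) : ℝ) - (M : ℝ) ^ 2 / 2 = 0 := by
    obtain ⟨k, rfl⟩ := hM
    have hk : (k + k) ^ 2 / 2 = 2 * k ^ 2 := by
      rw [show (k + k) ^ 2 = 2 * (2 * k ^ 2) by ring, Nat.mul_div_cancel_left _ (by norm_num)]
    rw [hk]
    push_cast
    ring
  rw [hlabel] at hmem heig
  -- normalise
  obtain ⟨a, ha0, ha1⟩ := exists_smul_unit hψ0
  refine ⟨a • ψ, Submodule.smul_mem _ _ hmem, ha1, ?_⟩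
  have heig' : xxzHamiltonian 1 (torusGraph 2 M) (-1) 0 *ᵥ ψ =
      ((lowestEnergyInSector 1 (xxzHamiltonian 1 (torusGraph 2 M) (-1) 0) 0 : ℝ) : ℂ) • ψ := heig
  rw [mulVec_smul, heig', smul_comm]

/-- **`ChordToOrderXY` holds** (route `AnisotropyChord`, item `stmt-HubbardSuperconductivity-8151`):
`ChordXY → SectorAnchorXY → HalfFilledOrder` with `c' = (1+Δ)c` and `M₀' = max(M₀, 4)`: at a
normalised KLS-point sector ground state `ψ₀` (`exists_unit_sectorGroundState_xy`) the anchor gives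
`Λ(ψ₀) ≥ cM⁴` and the chord gives `Λ(ψ) ≥ (1+Δ)Λ(ψ₀)`. [folklore] -/
theorem chordToOrderXY_proof : ChordToOrderXY := by
  intro hChord hAnchor Δ hΔ
  obtain ⟨c, hc, M₀, hA⟩ := hAnchor
  refine ⟨(1 + Δ) * c, mul_pos (by linarith [hΔ.1]) hc, max M₀ 4,
    fun M _ hM hMle ψ hmem hψ1 heig => ?_⟩
  have h4 : 4 ≤ M := le_of_max_le_right hMle
  have hM₀ : M₀ ≤ M := le_of_max_le_left hMle
  obtain ⟨ψ₀, hmem₀, hψ₀1, heig₀⟩ :=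
    exists_unit_sectorGroundState_xy M hM (le_trans (by norm_num) h4)
  have hA' := hA M hM hM₀ ψ₀ hmem₀ hψ₀1 heig₀
  have hC := hChord M hM h4 Δ ⟨hΔ.1.le, hΔ.2⟩ ψ₀ ψ hmem₀ hψ₀1 heig₀ hmem hψ1 heig
  have hΔ1 : 0 ≤ 1 + Δ := by linarith [hΔ.1]
  calc (1 + Δ) * c * (M : ℝ) ^ 4 = (1 + Δ) * (c * (M : ℝ) ^ 4) := by ring
    _ ≤ _ := mul_le_mul_of_nonneg_left hA' hΔ1
    _ ≤ _ := hC

end Summit.HubbardSuperconductivity.HubbardSuperconductivity.Theorems.AnisotropyChord
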